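import Summits.AtomisticToContinuum.HydrodynamicLimit.Theses.BallwiseInvariantReferences
import Summits.AtomisticToContinuum.HydrodynamicLimit.Theorems.OneFlightGossipEngineEnergyCurrentTailsLevelCensusObjects
import HarnessLib

/-!
# Birth skeleton (`Lines/birth.lean`) for the crux `FastCollisionThroughput`
# (stmt-AtomisticToContinuum-13022, route `BallwiseInvariantReferences`, rank 4) — skeleton-register, gen 1

Crux (verbatim the route decl `…Theses.BallwiseInvariantReferences.FastCollisionThroughput`): for
continuous profiles `a₀, θ₀ > 0`, `u₀` there is `σ₀ > 0` such that for `0 < σ < σ₀`, every classical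
hs-Euler solution on `[0,T)`, every flow family `Φ N` whose local-Gibbs fields converge at `t = 0`:
`∀ t < T ∀ η > 0 ∃ K ∃ N₀ ∀ N ≥ N₀`,
`(N+1)^{-4/3} E_{λ_N}[ Σᵢ Σ_{collision times s ∈ (0,t]} 𝟙{K < max(‖vᵢ(s⁻)‖,‖vᵢ(s)‖)} (1 + ‖vᵢ(s)+vᵢ(s⁻)‖/2) ‖vᵢ(s) − vᵢ(s⁻)‖ ] ≤ η`
(`(N+1)^{4/3}` = order of the number of collisions on `[0,t]`; `vᵢ(s⁻)` = `Function.leftLim`).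

## The line: CHARGE EVERY FAST COLLISION TO ITS FASTER INCOMING SPHERE

Kinematics of one elastic collision with incoming velocities `(v, w)`, `V := max(‖v‖,‖w‖)`:
energy conservation gives outgoing speeds `≤ √2·V`, and the velocity jump of either partner is the
normal component of `v − w`, of norm `≤ 2V`.  Hence if particle `i` is fast at level `K = 2M` in this
collision (pre- OR post-speed `> 2M`) then `V > √2·M`, i.e. the FASTER INCOMING sphere already had
pre-collisional energy `> M²`, and the crux weight of both partners together is
`≤ 2·(2V)(1 + (1+√2)V/2) ≤ 12 V²` once `V ≥ 1`.  So the throughput functional is dominated, collision by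
collision, by the PRE-ENERGY-WEIGHTED COUNT OF ENERGETIC COLLISIONS
`Σ_{collisions in (0,t]} 𝟙{M² < maxPre} · maxPre` read off the collision records of the flow
(`HardSphereFlow.collisionSum`, `maxPre`/`tailEvent` of the landed level-census objects of the sister
crux `EnergyCurrentTails`, stmt-9235) — stub B, provable now.  The dynamical content is then ONE
statement in the shared currency of that sister line: an ENERGETIC COLLISION-RATE CEILING (stub R) —
a sphere of speed `V > M` is the faster partner of at most `C·κ_N·V` expected collisions per unit time,
`κ_N = σ²(N+1)^{1/3}` (one-sided, ONE-RARE-PARTICIPANT Stosszahlansatz ceiling: no rattler / dense-cluster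
amplification around energetic spheres, pre-shock, under the TRUE law), which turns the weighted count
into `C (N+1)^{4/3} · sup_{s ≤ t} E[(N+1)⁻¹ Σᵢ 𝟙{M < ‖vᵢ(s)‖} ‖vᵢ(s)‖³]` — the CUBIC SPEED TAIL of
`EnergyCurrentTails` (stub T, the route's own rank-3 crux in sup-over-`[0,t]` / monotone-in-level
form).  Composition: throughput(2M) ≤ 12·(N+1)^{-4/3}·weightedCount(M) ≤ 12·C·sup-tail(M) ≤ 12·C·ε ≤ η.

Message to the route: `FastCollisionThroughput` is NOT independent of `EnergyCurrentTails`; given the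
cubic tails its own content is exactly the energetic rate ceiling R (+ the bookkeeping B).

## Stubs (3; sorries ONLY in `stub_*`)

* B `stub_throughputChargedToRecords : ThroughputChargedToRecords` — the crux functional at level `2M`
  is `≤ 12 (N+1)^{-4/3} ×` the expected pre-energy-weighted energetic-collision count at level `M`
  (`M ≥ 1`, every `σ > 0`, `N`, flow, `t`).  Pathwise on `Φ.good` (a.e. for `λ_N ≪` Liouville):
  `IsHardSphereTrajectory.locFinite` (honest finite sums), `binary` + `leftLim_eq_collidePair` /
  `ofConfig_preVel_eq_leftLim` (the record's `preVel` IS the left limit), the kinematics above, then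
  `lintegral_mono_ae` + `lintegral_const_mul'`.  Provable now; M/L-sized formal bookkeeping.
* R `stub_energeticCollisionRateCeiling : EnergeticCollisionRateCeiling` — THE HARDEST (dynamical,
  crux-strength): in the crux frame, `∀ t < T ∃ C > 0 ∃ M₁ ∃ N₀ ∀ M ≥ M₁ ∀ N ≥ N₀`,
  `(N+1)^{-4/3} E[Σ_coll 𝟙{M² < maxPre} maxPre] ≤ C · sup_{s∈[0,t]} cubicTail(s, M)`.  Second-moment /
  tail form of the count ceiling `RateCeiling` (F1 of line `level-census-comparison` of stmt-9235) and of
  `CollisionActivityTails` (stmt-13734); at equilibrium it is the Enskog contact flux (constant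
  `C ≍ σ² g₂(σ) √θ`).
* T `stub_cubicSpeedTailsUniform : CubicSpeedTailsUniform` — `∀ t < T ∀ ε > 0 ∃ M₀ ∃ N₀ ∀ M ≥ M₀ ∀ N ≥ N₀`,
  `sup_{s∈[0,t]} cubicTail(s, M) ≤ ε`: the conclusion of `EnergyCurrentTails` (stmt-9235, this route's
  rank-3 crux, shared) in `iSup`-over-`[0,t]`, monotone-in-`M` form — follows from it by `iSup₂_le` and
  `Set.indicator_le_indicator_of_subset`; open exactly as long as 9235 is.

## Disproof / negatives honoured

No `Disproof.lean` exists for this crux yet (`ledger crux ls stmt-…-13022`: no workfiles, 2026-08-17).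
Negatives index (20 for the summit): stmt-9218 `ContactIntensityDomination` [refuted-misstated, hot-spot
witness against a ceiling UNIFORM OVER ALL TWO-PARTICLE MARKS by the product of spatially averaged laws] —
R is of the repaired ONE-RARE-PARTICIPANT kind (`𝟙{M² < maxPre} maxPre ≤ ψ(v) + ψ(w)`, `ψ = 𝟙{M<‖·‖}‖·‖²`)
with a ONE-copy right-hand side (the cubic tail is a one-particle functional, automatically local in `x`),
so the hot-spot witness does not bite; stmt-13733 / stmt-14607 (exponential window-LD / exp-tail budgets
refuted) — no exponential moment or probability budget appears here, only expectations; the refuter's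
audit of 13022 itself (Evidence13022.lean: junk of `finsum`/`leftLim`/`flow` lives on the Liouville-null
bad set, not charged by `λ_N`) is what makes B an a.e. statement.

## BC3 probes (this seat, `bc/probes.lean`): for each stub S ∈ {B, R, T},
`S → FastCollisionThroughput` and `S → _root_.HydrodynamicLimit` by `first | exact? | simpa | aesop` FAIL.

References: Spohn 1991 Part I §3.3 (collision flux of hard spheres); Cercignani–Illner–Pulvirenti 1994
§4 (collision records); Burago–Ferleger–Kononenko 1998 (collision counting — no rates);
Gallagher–Saint-Raymond–Texier 2013 §4; Nachtergaele–Yau 2003 §2.3 (velocity cut-offs);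
Pulvirenti–Simonella 2017 (one-sided correlation bounds at low density).
-/

noncomputable section

open MeasureTheory Set Filter
open scoped ENNReal InnerProductSpace

namespace Summit.AtomisticToContinuum.HydrodynamicLimit.Cruxes.FastCollisionThroughput.Birth

open Literature.MathematicalPhysics.KineticTheory Literature.Analysis.FluidPDE
open Summit.AtomisticToContinuum.HydrodynamicLimit.Theorems.EnergyCurrentTailsLevelCensus
  (Flow VelEvent maxPre tailEvent)
open Summit.AtomisticToContinuum.HydrodynamicLimit.Theses.BallwiseInvariantReferences
  (FastCollisionThroughput)

/-! ## §0 Objects -/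

/-- The crux's own functional, verbatim: the normalised expected FAST-COLLISION THROUGHPUT at level `K`
on `(0,t]` of the flow `Φ` of `N+1` spheres under the local Gibbs law `λ_N`. -/
def fastThroughput (σ : ℝ) (a₀ θ₀ : T3 → ℝ) (u₀ : T3 → V3) (N : ℕ) (Φ : Flow σ N) (t K : ℝ) :
    ℝ≥0∞ :=
  ∫⁻ z, ENNReal.ofReal ((((N : ℝ) + 1) ^ (-(4 / 3 : ℝ))) * ∑ i : Fin (N + 1), ∑ᶠ s ∈ Literature.Analysis.FluidPDE.collisionTimes (Literature.Analysis.FluidPDE.Torus.geometry (Fin 3)) (Literature.MathematicalPhysics.KineticTheory.hsDiameter σ N) (fun s => Φ.flow s z) ∩ Set.Ioc 0 t, (if K < max ‖(Function.leftLim (fun s => Φ.flow s z) s i).2‖ ‖(Φ.flow s z i).2‖ then (1 + ‖(Φ.flow s z i).2 + (Function.leftLim (fun s => Φ.flow s z) s i).2‖ / 2) * ‖(Φ.flow s z i).2 - (Function.leftLim (fun s => Φ.flow s z) s i).2‖ else 0)) ∂(Literature.MathematicalPhysics.KineticTheory.localGibbsLaw σ a₀ u₀ θ₀ N Φ)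

/-- The expected PRE-ENERGY-WEIGHTED COUNT OF ENERGETIC COLLISIONS on `(0,t]` at level `M`:
`E_{λ_N} Σ_{(s; p,q) ordered contact pairs of the orbit, s ∈ (0,t]} 𝟙{M² < maxPre} · maxPre`, where
`maxPre = max(‖v_p⁻‖², ‖v_q⁻‖²)` is the larger PRE-collisional energy of the record (each physical collision
is listed once per ordered contact pair — twice under torus regularity; no `fst < snd` guard, the constant
of stub B absorbs nothing from it since one ordered pair already dominates). -/
def energeticCollisionWeight (σ : ℝ) (a₀ θ₀ : T3 → ℝ) (u₀ : T3 → V3) (N : ℕ) (Φ : Flow σ N)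
    (t M : ℝ) : ℝ≥0∞ :=
  ∫⁻ z, Φ.collisionSum (Set.Ioc 0 t)
      (fun c => Set.indicator (tailEvent (M ^ 2)) (fun q => ENNReal.ofReal (maxPre q))
        (c.preVel, c.postVel)) z
    ∂(localGibbsLaw σ a₀ u₀ θ₀ N Φ)

/-- The expected CUBIC SPEED TAIL at level `M` and time `s`:
`E_{λ_N}[(N+1)⁻¹ Σᵢ 𝟙{M < ‖vᵢ(s)‖} ‖vᵢ(s)‖³]` — verbatim the integrand of `EnergyCurrentTails` (stmt-9235). -/
def cubicTail (σ : ℝ) (a₀ θ₀ : T3 → ℝ) (u₀ : T3 → V3) (N : ℕ) (Φ : Flow σ N) (s M : ℝ) : ℝ≥0∞ :=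
  ∫⁻ z, ENNReal.ofReal (((N : ℝ) + 1)⁻¹ * ∑ i : Fin (N + 1),
      Set.indicator {v : V3 | M < ‖v‖} (fun v => ‖v‖ ^ 3) ((Φ.flow s z i).2))
    ∂(localGibbsLaw σ a₀ u₀ θ₀ N Φ)

/-! ## §1 The stub statements (named `Prop`s) -/

/-- **Stub B — THROUGHPUT IS CHARGED TO THE COLLISION RECORDS (bookkeeping + one-collision kinematics;
provable now).**  For every `σ > 0`, all profiles, `N`, flow `Φ`, window `(0,t]` and level `M ≥ 1`:
`fastThroughput(K = 2M) ≤ 12 · (N+1)^{-4/3} · energeticCollisionWeight(M)`.  (Fast at level `2M` ⟹ the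
faster incoming sphere has energy `> 2M² > M²`; both partners' weights together `≤ 12·maxPre`; a.e.
orbit is good, its collision times in `(0,t]` are finitely many and binary, and the record's `preVel` is the
left limit.) -/
def ThroughputChargedToRecords : Prop :=
  ∀ σ : ℝ, 0 < σ → ∀ (a₀ θ₀ : T3 → ℝ) (u₀ : T3 → V3) (N : ℕ) (Φ : Flow σ N) (t M : ℝ), 1 ≤ M →
    fastThroughput σ a₀ θ₀ u₀ N Φ t (2 * M) ≤
      ENNReal.ofReal 12 *
        (ENNReal.ofReal (((N : ℝ) + 1) ^ (-(4 / 3 : ℝ))) * energeticCollisionWeight σ a₀ θ₀ u₀ N Φ t M)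

/-- **Stub R — THE ENERGETIC COLLISION-RATE CEILING (dynamical; the hardest).**  In the frame of the crux
(continuous positive profiles, `σ < σ₀`, classical hs-Euler solution on `[0,T)`, flow family with
converging initial fields), for every `t < T` there are `C > 0`, a level threshold `M₁` and `N₀` with:
for `M ≥ M₁`, `N ≥ N₀`,
`(N+1)^{-4/3} · energeticCollisionWeight(t, M) ≤ C · sup_{s ∈ [0,t]} cubicTail(s, M)` —
energetic spheres are the faster partner of at most `C κ_N ‖v‖` expected collisions per unit time
(`κ_N = σ²(N+1)^{1/3}`; one-rare-participant, one-copy right-hand side). -/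
def EnergeticCollisionRateCeiling : Prop :=
  ∀ (a₀ θ₀ : T3 → ℝ) (u₀ : T3 → V3), Continuous a₀ → Continuous θ₀ → Continuous u₀ →
    (∀ x, 0 < a₀ x) → (∀ x, 0 < θ₀ x) →
    ∃ σ₀ : ℝ, 0 < σ₀ ∧ ∀ σ : ℝ, 0 < σ → σ < σ₀ →
      ∀ (T : ℝ) (ρ θ : ℝ → T3 → ℝ) (u : ℝ → T3 → V3), IsHardSphereEulerSolution σ T ρ u θ →
        ∀ Φ : (N : ℕ) → Flow σ N,
          TendstoHydroFieldsAt (fun N => localGibbsLaw σ a₀ u₀ θ₀ N (Φ N)) Φ ρ u θ 0 →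
            ∀ t ∈ Set.Ico 0 T, ∃ C : ℝ, 0 < C ∧ ∃ M₁ : ℝ, ∃ N₀ : ℕ, ∀ M : ℝ, M₁ ≤ M →
              ∀ N : ℕ, N₀ ≤ N →
                ENNReal.ofReal (((N : ℝ) + 1) ^ (-(4 / 3 : ℝ))) *
                    energeticCollisionWeight σ a₀ θ₀ u₀ N (Φ N) t M ≤
                  ENNReal.ofReal C * ⨆ s ∈ Set.Icc 0 t, cubicTail σ a₀ θ₀ u₀ N (Φ N) s M

/-- **Stub T — CUBIC SPEED TAILS, UNIFORMLY ON `[0,t]` (= the conclusion of `EnergyCurrentTails`,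
stmt-9235, in sup / monotone-level form).**  In the frame of the crux, for every `t < T` and `ε > 0` there
are `M₀`, `N₀` with `sup_{s ∈ [0,t]} cubicTail(s, M) ≤ ε` for all `M ≥ M₀`, `N ≥ N₀`. -/
def CubicSpeedTailsUniform : Prop :=
  ∀ (a₀ θ₀ : T3 → ℝ) (u₀ : T3 → V3), Continuous a₀ → Continuous θ₀ → Continuous u₀ →
    (∀ x, 0 < a₀ x) → (∀ x, 0 < θ₀ x) →
    ∃ σ₀ : ℝ, 0 < σ₀ ∧ ∀ σ : ℝ, 0 < σ → σ < σ₀ →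
      ∀ (T : ℝ) (ρ θ : ℝ → T3 → ℝ) (u : ℝ → T3 → V3), IsHardSphereEulerSolution σ T ρ u θ →
        ∀ Φ : (N : ℕ) → Flow σ N,
          TendstoHydroFieldsAt (fun N => localGibbsLaw σ a₀ u₀ θ₀ N (Φ N)) Φ ρ u θ 0 →
            ∀ t ∈ Set.Ico 0 T, ∀ ε : ℝ, 0 < ε → ∃ M₀ : ℝ, ∃ N₀ : ℕ, ∀ M : ℝ, M₀ ≤ M →
              ∀ N : ℕ, N₀ ≤ N →
                ⨆ s ∈ Set.Icc 0 t, cubicTail σ a₀ θ₀ u₀ N (Φ N) s M ≤ ENNReal.ofReal ε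

/-! ## §1b The stub statements BY STUB NAME — the hypotheses of `FastCollisionThroughput_of`

The native skeleton audit (`#h21_check_skeleton`, run by `ledger skeleton check`) admits a hypothesis of the
composing theorem only if its head constant is a registered obligation or is NAMED like a declared stub, and the
`@[stub]` tag is gate-reserved; so each statement is mirrored by the alias `abbrev __Registered.stub_X : Prop := X`
and `FastCollisionThroughput_of` is stated over the three aliases (device of the sibling birth skeletons, e.g.
`CriticalPhenomena/Ising3DConformalLimit/Cruxes/BallSpecifiedFieldLimit/Lines/birth.lean`; the `__` namespace is an
implementation detail, so the audit resolves each `stub_…` to the sorried theorem below, not to its alias).  The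
`example`s after §2 check that the registered theorems, the aliases and the named `Prop`s agree definitionally. -/
namespace __Registered

/-- Alias of stub B `ThroughputChargedToRecords`, keyed by the registered name `stub_throughputChargedToRecords`. -/
abbrev stub_throughputChargedToRecords : Prop := ThroughputChargedToRecords

/-- Alias of stub R `EnergeticCollisionRateCeiling`, keyed by the registered name `stub_energeticCollisionRateCeiling`. -/
abbrev stub_energeticCollisionRateCeiling : Prop := EnergeticCollisionRateCeiling

/-- Alias of stub T `CubicSpeedTailsUniform`, keyed by the registered name `stub_cubicSpeedTailsUniform`. -/
abbrev stub_cubicSpeedTailsUniform : Prop := CubicSpeedTailsUniform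

end __Registered

/-! ## §2 Registered stubs (the open obligations; sorries ONLY here; signatures = the statements verbatim) -/

/-- **Stub B** (= `ThroughputChargedToRecords`: bookkeeping + one-collision kinematics; provable now). -/
theorem stub_throughputChargedToRecords :
    ∀ σ : ℝ, 0 < σ → ∀ (a₀ θ₀ : T3 → ℝ) (u₀ : T3 → V3) (N : ℕ) (Φ : Flow σ N) (t M : ℝ), 1 ≤ M →
      fastThroughput σ a₀ θ₀ u₀ N Φ t (2 * M) ≤
        ENNReal.ofReal 12 *
          (ENNReal.ofReal (((N : ℝ) + 1) ^ (-(4 / 3 : ℝ))) * energeticCollisionWeight σ a₀ θ₀ u₀ N Φ t M) := by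
  sorry

/-- **Stub R** (= `EnergeticCollisionRateCeiling`: energetic collision-rate ceiling; dynamical, THE HARDEST). -/
theorem stub_energeticCollisionRateCeiling :
    ∀ (a₀ θ₀ : T3 → ℝ) (u₀ : T3 → V3), Continuous a₀ → Continuous θ₀ → Continuous u₀ →
      (∀ x, 0 < a₀ x) → (∀ x, 0 < θ₀ x) →
      ∃ σ₀ : ℝ, 0 < σ₀ ∧ ∀ σ : ℝ, 0 < σ → σ < σ₀ →
        ∀ (T : ℝ) (ρ θ : ℝ → T3 → ℝ) (u : ℝ → T3 → V3), IsHardSphereEulerSolution σ T ρ u θ →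
          ∀ Φ : (N : ℕ) → Flow σ N,
            TendstoHydroFieldsAt (fun N => localGibbsLaw σ a₀ u₀ θ₀ N (Φ N)) Φ ρ u θ 0 →
              ∀ t ∈ Set.Ico 0 T, ∃ C : ℝ, 0 < C ∧ ∃ M₁ : ℝ, ∃ N₀ : ℕ, ∀ M : ℝ, M₁ ≤ M →
                ∀ N : ℕ, N₀ ≤ N →
                  ENNReal.ofReal (((N : ℝ) + 1) ^ (-(4 / 3 : ℝ))) *
                      energeticCollisionWeight σ a₀ θ₀ u₀ N (Φ N) t M ≤
                    ENNReal.ofReal C * ⨆ s ∈ Set.Icc 0 t, cubicTail σ a₀ θ₀ u₀ N (Φ N) s M := by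
  sorry

/-- **Stub T** (= `CubicSpeedTailsUniform`: uniform cubic speed tails on `[0,t]`; = the output of crux stmt-9235). -/
theorem stub_cubicSpeedTailsUniform :
    ∀ (a₀ θ₀ : T3 → ℝ) (u₀ : T3 → V3), Continuous a₀ → Continuous θ₀ → Continuous u₀ →
      (∀ x, 0 < a₀ x) → (∀ x, 0 < θ₀ x) →
      ∃ σ₀ : ℝ, 0 < σ₀ ∧ ∀ σ : ℝ, 0 < σ → σ < σ₀ →
        ∀ (T : ℝ) (ρ θ : ℝ → T3 → ℝ) (u : ℝ → T3 → V3), IsHardSphereEulerSolution σ T ρ u θ →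
          ∀ Φ : (N : ℕ) → Flow σ N,
            TendstoHydroFieldsAt (fun N => localGibbsLaw σ a₀ u₀ θ₀ N (Φ N)) Φ ρ u θ 0 →
              ∀ t ∈ Set.Ico 0 T, ∀ ε : ℝ, 0 < ε → ∃ M₀ : ℝ, ∃ N₀ : ℕ, ∀ M : ℝ, M₀ ≤ M →
                ∀ N : ℕ, N₀ ≤ N →
                  ⨆ s ∈ Set.Icc 0 t, cubicTail σ a₀ θ₀ u₀ N (Φ N) s M ≤ ENNReal.ofReal ε := by
  sorry

/-- The registered theorems, the `__Registered` aliases and the named `Prop`s are the same statements. -/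
example : __Registered.stub_throughputChargedToRecords := stub_throughputChargedToRecords
example : __Registered.stub_energeticCollisionRateCeiling := stub_energeticCollisionRateCeiling
example : __Registered.stub_cubicSpeedTailsUniform := stub_cubicSpeedTailsUniform
example : ThroughputChargedToRecords = __Registered.stub_throughputChargedToRecords := rfl
example : EnergeticCollisionRateCeiling = __Registered.stub_energeticCollisionRateCeiling := rfl
example : CubicSpeedTailsUniform = __Registered.stub_cubicSpeedTailsUniform := rfl

/-! ## §3 Composition (sorry-free): the three stubs ⟹ the crux BY NAME -/

/-- **THE SKELETON THEOREM**: B → R → T → `BallwiseInvariantReferences.FastCollisionThroughput` (the crux BY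
NAME; hypotheses = the three registered stubs by name, via their `__Registered` aliases).
Take `σ₀ = min` of the two thresholds; given `t < T`, `η > 0`: `C, M₁, N₁` from R, then `M₀, N₂` from T
at `ε = η / (12 (C+1))`, level `M = max(M₀, M₁, 1)`, cut `K = 2M`, `N ≥ max(N₁, N₂)`:
`throughput(2M) ≤ 12·((N+1)^{-4/3}·count(M)) ≤ 12·(C·sup-tail(M)) ≤ 12·C·ε ≤ η`. -/
theorem FastCollisionThroughput_of :
    __Registered.stub_throughputChargedToRecords → __Registered.stub_energeticCollisionRateCeiling →
      __Registered.stub_cubicSpeedTailsUniform → FastCollisionThroughput := by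
  intro hB hR hT a₀ θ₀ u₀ ha hθ hu hap hθp
  obtain ⟨σ₁, hσ₁, H1⟩ := hR a₀ θ₀ u₀ ha hθ hu hap hθp
  obtain ⟨σ₂, hσ₂, H2⟩ := hT a₀ θ₀ u₀ ha hθ hu hap hθp
  refine ⟨min σ₁ σ₂, lt_min hσ₁ hσ₂, ?_⟩
  intro σ hσ hσlt T ρ θ u hsol Φ h0 t ht η hη
  have hσ1 : σ < σ₁ := lt_of_lt_of_le hσlt (min_le_left _ _)
  have hσ2 : σ < σ₂ := lt_of_lt_of_le hσlt (min_le_right _ _)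
  obtain ⟨C, hC, M₁, N₁, HR⟩ := H1 σ hσ hσ1 T ρ θ u hsol Φ h0 t ht
  have hC1 : (0 : ℝ) < 12 * (C + 1) := by positivity
  obtain ⟨M₀, N₂, HT⟩ := H2 σ hσ hσ2 T ρ θ u hsol Φ h0 t ht (η / (12 * (C + 1))) (div_pos hη hC1)
  obtain ⟨M, hM₀, hM₁, hM1⟩ : ∃ M : ℝ, M₀ ≤ M ∧ M₁ ≤ M ∧ 1 ≤ M :=
    ⟨max (max M₀ M₁) 1, (le_max_left _ _).trans (le_max_left _ _),
      (le_max_right _ _).trans (le_max_left _ _), le_max_right _ _⟩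
  refine ⟨2 * M, max N₁ N₂, fun N hN => ?_⟩
  have hN₁ : N₁ ≤ N := (le_max_left _ _).trans hN
  have hN₂ : N₂ ≤ N := (le_max_right _ _).trans hN
  show fastThroughput σ a₀ θ₀ u₀ N (Φ N) t (2 * M) ≤ ENNReal.ofReal η
  calc fastThroughput σ a₀ θ₀ u₀ N (Φ N) t (2 * M)
      ≤ ENNReal.ofReal 12 * (ENNReal.ofReal (((N : ℝ) + 1) ^ (-(4 / 3 : ℝ))) *
          energeticCollisionWeight σ a₀ θ₀ u₀ N (Φ N) t M) :=
        hB σ hσ a₀ θ₀ u₀ N (Φ N) t M hM1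
    _ ≤ ENNReal.ofReal 12 * (ENNReal.ofReal C * ⨆ s ∈ Set.Icc 0 t, cubicTail σ a₀ θ₀ u₀ N (Φ N) s M) :=
        mul_le_mul' le_rfl (HR M hM₁ N hN₁)
    _ ≤ ENNReal.ofReal 12 * (ENNReal.ofReal C * ENNReal.ofReal (η / (12 * (C + 1)))) :=
        mul_le_mul' le_rfl (mul_le_mul' le_rfl (HT M hM₀ N hN₂))
    _ = ENNReal.ofReal (12 * (C * (η / (12 * (C + 1))))) := by
        rw [ENNReal.ofReal_mul (by norm_num : (0 : ℝ) ≤ 12), ENNReal.ofReal_mul hC.le]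
    _ ≤ ENNReal.ofReal η := by
        refine ENNReal.ofReal_le_ofReal ?_
        have hx : 0 ≤ η / (12 * (C + 1)) := (div_pos hη hC1).le
        calc 12 * (C * (η / (12 * (C + 1))))
            ≤ 12 * ((C + 1) * (η / (12 * (C + 1)))) := by
              have : C * (η / (12 * (C + 1))) ≤ (C + 1) * (η / (12 * (C + 1))) :=
                mul_le_mul_of_nonneg_right (by linarith) hx
              linarith
          _ = η / (12 * (C + 1)) * (12 * (C + 1)) := by ring
          _ = η := div_mul_cancel₀ η hC1.ne'

/-- **The line's closing theorem, modulo the three registered stubs** (sorry-free once they are). -/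
theorem FastCollisionThroughput_proof : FastCollisionThroughput :=
  FastCollisionThroughput_of stub_throughputChargedToRecords stub_energeticCollisionRateCeiling
    stub_cubicSpeedTailsUniform

end Summit.AtomisticToContinuum.HydrodynamicLimit.Cruxes.FastCollisionThroughput.Birth

end
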